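import Summits.QuantumFields.YangMills.Theorems.BalabanUVNodesN15RealKernels
import Summits.QuantumFields.YangMills.Theorems.BalabanUVNodesN15VectorPieceSized
import HarnessLib

/-!
# Route «BalabanUVNodes» (K4 «SpineRates»), node N15 = NE2, -a lane, part 28: the BY-NAME operator layer for the SIZED U = 1 vector piece, WITH CONTENT —
# `T4EtaRate.NE2ZeroOperator` ∕ `NE2PlusOperator` on part 25's sized family, concluded from part 24's guard-free (3.42) content through part 25's certificates

Cell `pub-ymgap`, seat `pub-ymgap-dag-n15-a` (KNIT-BY-NAME, generation g5; HUMAN RULING D-0062; chair R424 venue; `bears_on: R4∕N15`).  Filed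
`--supports stmt-QuantumFields-19676` (helper; K3).  THEOREMS ONLY; imports BY NAME part 24 (`etaRateIneq342_vec_all`) and part 25 (`vecInstanceS`, `vecFamilyS`,
`ne2ZeroOperator_vecS_iff`, `ne2PlusOperator_vecS_iff`).  This is the leaf split off part 25 v1 (whose only import of part 24 it was) while part 24's hub olean was
pending; nothing else.

CONTENTS: **`ne2ZeroOperator_vecS`**, **`ne2PlusOperator_vecS`** (the by-name predicates on the sized family — size guard LIVE (`exists_vecIndexS_size_ge`), and by
part 25 §2 EQUIVALENT to the guard-free content, so NOT vacuous), `ne2ZeroOperator_vecS_dim4`.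

HONEST FRAMING ∕ LIMITS.  Two-line corollaries; no estimate here.  `U = 1` LINEAR theory on FINITE tori (NE2⁰ content inside NE2⁺'s type: the «+» block inert on
the one-point carrier — for the background-LIVE statement see part 27); one single-scale piece, NOT the multiscale carrier (NODE 00); NE2⁺ proper (U ≠ 1) NOT
PRINTED ∕ not proved.  Count-neutral; NOT a discharge of N15; one finite T⁴ at fixed ε — NOT infinite volume, NOT OS on ℝ⁴, NOT a mass gap, NOT Clay.
-/

noncomputable section

namespace Summit.QuantumFields.YangMills.BalabanUVNodes.N15.VectorPiece

open Literature.MathematicalPhysics.QuantumFieldTheory.Balaban1983to89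
open Literature.MathematicalPhysics.QuantumFieldTheory.Balaban1983to89.T4EtaRate (NE2PlusOperator NE2ZeroOperator)

variable {d : ℕ} {L : ℕ} [NeZero L]

/-- **NE2⁰, OPERATOR LAYER, BY NAME, LIVE GUARD**: the sized realised family of the U = 1 vector single-scale piece with the four concrete (3.42) entries satisfies
`T4EtaRate.NE2ZeroOperator` — equivalent (part 25 `ne2ZeroOperator_vecS_iff`) to part 24's `etaRateIneq342_vec_all`, from which it is concluded.
[cite: Balaban1985BackgroundPropagators, Thm 3.1 (3.42) p.397 (shape); King1986, Props. 3.8–3.9 (3.71)–(3.75) pp.664–665 (A = 0 model)] -/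
theorem ne2ZeroOperator_vecS (hd : 1 ≤ d) (hL : 1 ≤ L) :
    NE2ZeroOperator (vecInstanceS (d := d) hL) (vecFamilyS hL fun i : VecIndex d L => entry3 (d := d) L i.k i.m i.Mn) :=
  (ne2ZeroOperator_vecS_iff hL _).mpr (etaRateIneq342_vec_all hd hL)

/-- **NE2⁺, OPERATOR LAYER — the node's FIRST CONJUNCT `T4EtaRate.NE2PlusOperator` BY NAME, LIVE GUARD**, for the sized U = 1 vector piece (the «+» block inert
on the one-point carrier — NE2⁰ content, said); equivalent (part 25 `ne2PlusOperator_vecS_iff`) to part 24's guard-free statement.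
[cite: Balaban1985BackgroundPropagators, Thm 3.1 p.397 (quantifier template)] -/
theorem ne2PlusOperator_vecS (hd : 1 ≤ d) (hL : 1 ≤ L) (c35 : ℝ) :
    NE2PlusOperator c35 (vecInstanceS (d := d) hL) (vecFamilyS hL fun i : VecIndex d L => entry3 (d := d) L i.k i.m i.Mn) :=
  (ne2PlusOperator_vecS_iff hL c35 _).mpr (etaRateIneq342_vec_all hd hL)

/-- The four-dimensional instance (`d + 1 = 4`), by name with a live guard. [cite: Balaban1985BackgroundPropagators, Thm 3.1 (3.42) p.397 (shape)] -/
theorem ne2ZeroOperator_vecS_dim4 (hL : 1 ≤ L) :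
    NE2ZeroOperator (vecInstanceS (d := 3) hL) (vecFamilyS hL fun i : VecIndex 3 L => entry3 (d := 3) L i.k i.m i.Mn) :=
  ne2ZeroOperator_vecS (d := 3) (by norm_num) hL

end Summit.QuantumFields.YangMills.BalabanUVNodes.N15.VectorPiece

end
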